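import Summits.QuantumFields.YangMills.Theorems.BalabanUVNodesN19MGFKernelTowerMGF
import Summits.QuantumFields.YangMills.Theorems.BalabanUVNodesN20ByValueKernelSteps
import Literature.MathematicalPhysics.QuantumFieldTheory.Balaban1983to89.T4Spectator

/-!
# BalabanUVNodes ∕ N19 (NE7 proper) — THE DRESSING SURFACES: the class measure of slots (module A `classMeasureOfSlots`) PUSHED FORWARD by the K-fold averaging of record IS
# Haar with density `χ_k(s)·mass_k(s)`; along any bond relabelling onto any torus the same with ONE reference measure — so module 28∕30's REP⁰ hypothesis is a THEOREM at the
# selectors of record (lens decomp v9 M32, ROW REP-REC)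

Cell `pub-ymgap` (HUMAN RULING D-0062, Track A), R134 ACCELERATION seat `pub-ymgap-dag-n19-d` (strategy s2), gen 7, module 31.  Lens decomp v9 [LENS-DECOMP-V9] (INBOX l.17426; memo
`ym-lens-BalabanUVNodes-decomp/LENS-decomp.md` v9 96de5b5fab2eeb40; sketch `lean/LensDecompNE7v9.sketch.lean` 3fb2bf866e40242b, 323 l., farm rc 0): «ROW REP-REC → n19-d = lift sketch v9 §1 (minus
`ae_fibre_condLaw` — CITE n20-d∕t4) + §2 into one file … + the `hrep`-FREE corollary» — §1∕§2 LIFTED HERE decl by decl (CREDITED; `ae_fibre_condLaw` is dag-n20-d's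
`N20ByValueKernelSteps.ae_fibre_condLaw`, CITED); the corollary at MODULE B's objects is module 31b `…N19LedgerDressAtRecordUnit` (next file; it imports module 30).  Filed `--kind proof --supports
stmt-QuantumFields-20292 --as helper` (K3⁗).  COUNT-NEUTRAL.  THEOREMS ONLY; no Theses import; edits nothing.

THE POINT (lens v9).  (ρ3) `slotMeasure k s V` is carried by the fibre `{U | iter_k U = V}` for `Haar_k`-a.e. `V` (`slotMeasure_fibre_ae`; HaarAC-FREE via module A §1
`withDensity_margDensity_le`), whence (ρ4) every dressing `h ∘ iter_k` SURFACES: dressed slot `=ᵐ[Haar_k] h · vacuum slot` (`texpA_dressed_ae_eq_mul_vacuum`) and the class weight is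
`∫ (χ_k(s)·vacuumSlot_k(s)) · h dHaar_k` (`integral_chi_mul_dressed_eq`) — module 28's dressed FORMAT with `L.μ K t τ := fieldMeasure` (t-free, τ-free), integrand `χ·vacuumSlot`, `Wt := φ`,
`fld := id`; THE MEASURE FORM = module 30's `hrep` LITERALLY: `(classMeasureOfSlots k s).map iter_k = Haar_k.withDensity (χ_k(s)·mass_k(s))` (`map_iter_classMeasureOfSlots`), composed with any
measurable reading `rd` (`map_comp_iter_classMeasureOfSlots`), and along a bond RELABELLING `ε` onto any torus `P', j'`: `= Haar_{P',j'}.withDensity ((χ·mass) ∘ relabel ε.symm)`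
(`map_relabel_iter_classMeasureOfSlots`, t4 `map_relabel_fieldMeasure`) — ONE reference measure for all `K t τ` and both runs.
Pieces IN THE TREE, cited: (ρ1) `T4AveragingDisintegration.condLaw_fibre_ae` ∕ n20-d `ae_fibre_condLaw`; (ρ2) module A `liveFactor` ∕ `rstepOfSel_id_TexpA_*`; `T4Continuum.Averaging.iter`.

HONEST FRAMING.  [folklore ∕ bookkeeping] measure theory (Mathlib `Measure.bind`, `withDensity`, `ae_ae_of_ae_comp`, disintegration) on this seat's typed objects; valid at the IDENTITY
selector (and the LIVE selector via module B's `classWeightOfDatum₉_ppSelLive_eq_ppSelId`); at a contentful selector REP⁰ needs `T4Spectator.PreservesFibreIntegrals` (NOT printed; lens O11).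
ZERO ESTIMATE CONTENT; nothing of Bałaban's asserted; NE7 NOT proved; N19 NOT discharged (0∕1); K3⁗ NOT claimed; counts UNMOVED (typed 28∕28 · discharged 5∕27, A 5∕28); one finite four-torus
programme at fixed `ε` — NOT ℝ⁴ ∕ OS ∕ mass gap ∕ Clay.  Print loci for the SHAPE read: [Balaban1987RG1] (0.13) p.254; [Balaban1988Convergent] (2.18) p.257, (3.24)–(3.25) p.270; [Balaban1989LargeFieldI]
(0.3)–(0.4) p.176.  No `sorry`, no `axiom`, no `instance`, no `notation`, 0 `def`; no decl below carries a cite tag.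
-/

open MeasureTheory ProbabilityTheory
open scoped ENNReal
open Literature.MathematicalPhysics.QuantumFieldTheory.Balaban1983to89
open Literature.MathematicalPhysics.QuantumFieldTheory.Balaban1983to89.Node00
open T4Continuum T4TermReprCoupling B14.Eq218Concrete
open T4AveragingDisintegration hiding SU
open Summit.QuantumFields.YangMills.BalabanUVNodes.N19MGFKernelTower
open Summit.QuantumFields.YangMills.BalabanUVNodes (N20ByValueKernelSteps.ae_fibre_condLaw)

namespace Summit.QuantumFields.YangMills.BalabanUVNodes.N19ClassMeasurePushforward

/-! ## §1 ENGINE — fibre-carried measures survive `•`, `withDensity`, `bind`; the a.e. upgrade along a sub-marginal density;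
disintegration transfer of an a.e. statement to the conditional kernel; the dressing surfaces (lintegral form). [folklore] -/

section Engine

variable {X Y : Type*} [MeasurableSpace X] [MeasurableSpace Y]

/-- A.e. statements descend along `≤` of measures. Lens v9 sketch, lifted. [folklore] -/
theorem ae_of_le {m m' : Measure X} (hle : m ≤ m') {p : X → Prop} (h : ∀ᵐ x ∂m', p x) : ∀ᵐ x ∂m, p x :=
  (Measure.absolutelyContinuous_of_le hle).ae_le h

/-- A.e. statements survive `withDensity`. Lens v9 sketch, lifted. [folklore] -/
theorem ae_withDensity_of_ae {m : Measure X} (f : X → ℝ≥0∞) {p : X → Prop} (h : ∀ᵐ x ∂m, p x) :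
    ∀ᵐ x ∂(m.withDensity f), p x :=
  (withDensity_absolutelyContinuous m f).ae_le h

/-- **FIBRE-CARRIED PIECES BIND TO A FIBRE-CARRIED MEASURE**: if `m`-a.e. `y` has `(Q y)`-a.e. `p`, then `(m.bind Q)`-a.e. `p`
(measurable `{p}`; a.e.-measurable `Q`). Lens v9 sketch, lifted. [folklore] -/
theorem ae_bind_of_ae_ae {m : Measure Y} {Q : Y → Measure X} (hQ : AEMeasurable Q m) {p : X → Prop}
    (hp : MeasurableSet {x | p x}) (h : ∀ᵐ y ∂m, ∀ᵐ x ∂(Q y), p x) : ∀ᵐ x ∂(m.bind Q), p x := by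
  rw [ae_iff, ← Set.compl_setOf, Measure.bind_apply hp.compl hQ]
  refine (lintegral_eq_zero_iff' ((Measure.measurable_coe hp.compl).comp_aemeasurable hQ)).2 ?_
  filter_upwards [h] with y hy
  rw [Pi.zero_apply, Set.compl_setOf]
  exact ae_iff.1 hy

/-- **THE A.E. UPGRADE ALONG A SUB-MARGINAL DENSITY** (HaarAC-free): if `μ.withDensity f ≤ m'` then an `m'`-a.e. statement holds
`μ`-a.e. OFF the zero set of `f` (`ae_withDensity_iff`). Lens v9 sketch, lifted. [folklore] -/
theorem ae_imp_of_withDensity_le {μ m' : Measure Y} {f : Y → ℝ≥0∞} (hf : Measurable f) (hle : μ.withDensity f ≤ m')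
    {p : Y → Prop} (h : ∀ᵐ y ∂m', p y) : ∀ᵐ y ∂μ, f y ≠ 0 → p y :=
  (ae_withDensity_iff hf).1 (ae_of_le hle h)

omit [MeasurableSpace Y] in
/-- **THE DRESSING SURFACES** (lintegral form): on a measure carried by the fibre `{x | T x = y}`, every `G ∘ T` integrates to
`G y ·` mass. Lens v9 sketch, lifted. [folklore] -/
theorem lintegral_comp_eq_mul_of_ae_fibre {m : Measure X} {T : X → Y} {y : Y} (h : ∀ᵐ x ∂m, T x = y) (G : Y → ℝ≥0∞) :
    ∫⁻ x, G (T x) ∂m = G y * m Set.univ := by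
  have e : (fun x => G (T x)) =ᵐ[m] fun _ => G y := h.mono fun x hx => by show G (T x) = G y; rw [hx]
  rw [lintegral_congr_ae e, lintegral_const]

omit [MeasurableSpace Y] in
/-- **PUSH-FORWARD OF A MEASURE-WITH-DENSITY ALONG A MAP WITH A MEASURABLE LEFT INVERSE**: `(μ.withDensity F).map e =
(μ.map e).withDensity (F ∘ e')` when `e' ∘ e = id` (`setLIntegral_map`). Lens v9 sketch, lifted. [folklore] -/
theorem map_withDensity_of_leftInverse {X' : Type*} [MeasurableSpace X'] (μ : Measure X) {F : X → ℝ≥0∞} (hF : Measurable F)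
    {e : X → X'} (he : Measurable e) {e' : X' → X} (he' : Measurable e') (hinv : ∀ x, e' (e x) = x) :
    (μ.withDensity F).map e = (μ.map e).withDensity (F ∘ e') := by
  ext B hB
  rw [Measure.map_apply he hB, withDensity_apply _ (hB.preimage he), withDensity_apply _ hB,
    setLIntegral_map hB (hF.comp he') he]
  exact lintegral_congr fun x => by simp only [Function.comp_apply, hinv]

variable [StandardBorelSpace X] [Nonempty X]

/- `ae_fibre_condLaw` (the conditional kernel of a map lives on its fibres, a.e. form) is dag-n20-d's
`Summit.QuantumFields.YangMills.BalabanUVNodes.N20ByValueKernelSteps.ae_fibre_condLaw` (p-landed; CITED below, not re-declared). -/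

/-- **DISINTEGRATION TRANSFER**: a `ν`-a.e. statement holds `(condLaw ν avg y)`-a.e. for `(ν.map avg)`-a.e. `y` — because
`condLaw ν avg ∘ₘ ν.map avg = ν` (`fst_compProd_condLaw` + `jointLaw_fst∕snd` + `Measure.snd_compProd`) and `Measure.ae_ae_of_ae_comp`. Lens v9 sketch, lifted. [folklore] -/
theorem ae_ae_condLaw_of_ae (ν : Measure X) [IsFiniteMeasure ν] {avg : X → Y} (havg : Measurable avg) {p : X → Prop}
    (h : ∀ᵐ x ∂ν, p x) : ∀ᵐ y ∂(ν.map avg), ∀ᵐ x ∂(condLaw ν avg y), p x := by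
  have e : condLaw ν avg ∘ₘ ν.map avg = ν := by
    rw [← jointLaw_fst ν havg, ← Measure.snd_compProd, fst_compProd_condLaw, jointLaw_snd ν havg]
  exact Measure.ae_ae_of_ae_comp (by rw [e]; exact h)

end Engine

/-! ## §2 AT NODE 00's OBJECTS — (ρ3) the slot measures of module A are fibre-carried; (ρ4) the dressing surfaces -/

section Record

variable {F : T4Family} {N : ℕ} [NeZero N] {ν : Stage7Numerics} {τ : TowerNumerics}
variable {w : StepWeightsOfRecord F N ν τ.M} {p : B12.RunParams} {g : ℕ → ℝ}

/-- ★ **(ρ3) THE SLOT MEASURES ARE CARRIED BY THE FIBRES OF THE ITERATED AVERAGING OF RECORD, `Haar_k`-a.e.**  For every level `k`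
and sequence `s`, for `fieldMeasure`-a.e. coarse field `V`, `slotMeasure k s V`-a.e. fine field `U` has `iter_k U = V`.  Induction on
the level: level 0 is `ofReal (b U) • δ_U`; at level k+1 the level-k statement is transferred to the averaging kernel
(`ae_ae_condLaw_of_ae`), paired with the kernel's own fibre support (`ae_fibre_condLaw`), upgraded from `(Haar_k.map avg_k)`-a.e. to
`Haar_{k+1}`-a.e. off the zero set of the marginal density (`withDensity_margDensity_le`, NO `HaarAC`), and pushed through
`liveFactor •`, `avgDensity •`, `withDensity (w·χ_k)`, `bind` (§1).  [folklore ∕ bookkeeping on module A's objects] -/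
theorem slotMeasure_fibre_ae
    (hwm : ∀ k s', Measurable fun z : GaugeField (F.P p.K) (k + 1) (SU N) × GaugeField (F.P p.K) k (SU N) => w p g k s' z.2 z.1)
    (hχm : ∀ k s, Measurable (chiSeqOfRecord F N ν τ.M g p.K k s)) {b : GaugeField (F.P p.K) 0 (SU N) → ℝ} (hbm : Measurable b) :
    ∀ (k : ℕ) (s : SeqOfRecord F ν τ.M g p.K k),
      ∀ᵐ V ∂(fieldMeasure (F.P p.K) k (SU N)), ∀ᵐ U ∂(slotMeasure F N ν τ w p g b k s V),
        Averaging.iter (avOfRecord F N p.K) k U = V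
  | 0, s => by
      refine Filter.Eventually.of_forall fun V => ?_
      rw [slotMeasure_zero]
      refine Measure.ae_smul_measure ?_ _
      exact (ae_dirac_iff (measurableSet_eq_fun
        (measurable_iter (avOfRecord F N p.K) (avOfRecord_measurable F N p.K) 0) measurable_const)).2 rfl
  | k + 1, s' => by
      have hav : Measurable (avOfRecord F N p.K k).avg := avOfRecord_measurable F N p.K k
      have ih := slotMeasure_fibre_ae hwm hχm hbm k s'.init
      -- (b) transfer the level-k statement to the averaging kernel and pair it with the kernel's fibre support
      have h1 : ∀ᵐ V' ∂((fieldMeasure (F.P p.K) k (SU N)).map (avOfRecord F N p.K k).avg),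
          ∀ᵐ V ∂(avgKernel (avOfRecord F N p.K k).avg V'),
            (avOfRecord F N p.K k).avg V = V' ∧
              ∀ᵐ U ∂(slotMeasure F N ν τ w p g b k s'.init V), Averaging.iter (avOfRecord F N p.K) k U = V := by
        filter_upwards [N20ByValueKernelSteps.ae_fibre_condLaw (fieldMeasure (F.P p.K) k (SU N)) hav,
          ae_ae_condLaw_of_ae (fieldMeasure (F.P p.K) k (SU N)) hav ih] with V' hf hg
        exact hf.and hg
      -- (c) upgrade to `Haar_{k+1}`-a.e. off the zero set of the marginal density (HaarAC-free)
      have h2 := ae_imp_of_withDensity_le (measurable_margDensity.coe_nnreal_ennreal)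
        (withDensity_margDensity_le (fieldMeasure (F.P p.K) k (SU N)) (fieldMeasure (F.P p.K) (k + 1) (SU N)) hav) h1
      filter_upwards [h2] with V' hV'
      -- (d) push through the level-(k+1) recursion `liveFactor • (avgDensity • ((avgKernel V').withDensity (w·χ)).bind (level k))`
      rw [slotMeasure_succ]
      refine Measure.ae_smul_measure ?_ _
      unfold preSlotMeasure
      by_cases h0 : (avgDensity (avOfRecord F N p.K k).avg V' : ℝ≥0∞) = 0
      · rw [h0, zero_smul, ae_zero]
        exact Filter.eventually_bot
      · refine Measure.ae_smul_measure ?_ _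
        refine ae_bind_of_ae_ae (measurable_slotMeasure hwm hχm hbm k s'.init).aemeasurable
          (measurableSet_eq_fun (measurable_iter (avOfRecord F N p.K) (avOfRecord_measurable F N p.K) (k + 1))
            measurable_const) ?_
        refine ae_withDensity_of_ae _ ?_
        filter_upwards [hV' h0] with V hV
        filter_upwards [hV.2] with U hU
        rw [T4Spectator.iter_succ_apply, hU, hV.1]

/-- **(ρ4-a) EVERY FUNCTION OF THE ITERATED AVERAGE SURFACES UNDER THE SLOT MEASURES**, `Haar_k`-a.e.:
`∫⁻ G(iter_k U) d(slotMeasure k s V)(U) = G V · slotMeasure k s V univ`. [folklore ∕ bookkeeping] -/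
theorem lintegral_comp_iter_slotMeasure_ae
    (hwm : ∀ k s', Measurable fun z : GaugeField (F.P p.K) (k + 1) (SU N) × GaugeField (F.P p.K) k (SU N) => w p g k s' z.2 z.1)
    (hχm : ∀ k s, Measurable (chiSeqOfRecord F N ν τ.M g p.K k s)) {b : GaugeField (F.P p.K) 0 (SU N) → ℝ} (hbm : Measurable b)
    (k : ℕ) (s : SeqOfRecord F ν τ.M g p.K k) (G : GaugeField (F.P p.K) k (SU N) → ℝ≥0∞) :
    ∀ᵐ V ∂(fieldMeasure (F.P p.K) k (SU N)),
      ∫⁻ U, G (Averaging.iter (avOfRecord F N p.K) k U) ∂(slotMeasure F N ν τ w p g b k s V)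
        = G V * slotMeasure F N ν τ w p g b k s V Set.univ := by
  filter_upwards [slotMeasure_fibre_ae hwm hχm hbm k s] with V hV
  exact lintegral_comp_eq_mul_of_ae_fibre hV G

/-- ★ **(ρ4-b) THE DRESSING SURFACES AT THE IDENTITY SELECTOR**: run def-T's start-generic tower (`texpAOfRecordFrom`, R-step
`rstepSlotOfRecord … ppSel` with `ppSel` the identity at every positive level, step weights `0 ≤ w` jointly measurable, `χ_k` measurable)
from the start `(h ∘ iter_k)·b` (`0 < m ≤ h ≤ M`, `h` measurable, reference start `b ≥ 0` measurable) and from `b` itself: at level `k`,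
for EVERY sequence `s`, the dressed slot IS `h(V) ·` the undressed slot for `Haar_k`-a.e. `V` — module A's representation theorem
(`texpAOfRecordFrom_eq_toReal_lintegral_slotMeasure`, twice) + (ρ4-a).  At the record: `k = p.K`, `h = e^{t·φ}`, `b = boltzmann`,
`φ ∘ iter_K = prodObs` (n19-d `prodObs_eq_prodW_comp_A` shape).  [folklore ∕ bookkeeping] -/
theorem texpA_dressed_ae_eq_mul_vacuum {ppSel : PpSelOfRecord F ν τ.M}
    (hsel : ∀ (k : ℕ) (s : SeqOfRecord F ν τ.M g p.K (k + 1)), ppSel p g (k + 1) s = s)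
    (hw0 : ∀ k s' U V', 0 ≤ w p g k s' U V')
    (hwm : ∀ k s', Measurable fun z : GaugeField (F.P p.K) (k + 1) (SU N) × GaugeField (F.P p.K) k (SU N) => w p g k s' z.2 z.1)
    (hχm : ∀ k s, Measurable (chiSeqOfRecord F N ν τ.M g p.K k s))
    {b : GaugeField (F.P p.K) 0 (SU N) → ℝ} (hbm : Measurable b) (hb0 : ∀ U, 0 ≤ b U)
    (k : ℕ) {h : GaugeField (F.P p.K) k (SU N) → ℝ} (hhm : Measurable h) {m M : ℝ} (hm : 0 < m) (hM0 : 0 ≤ M)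
    (hlo : ∀ V, m ≤ h V) (hhi : ∀ V, h V ≤ M)
    {start₁ start₀ : (p : B12.RunParams) → (ℕ → ℝ) → Density (F.P p.K) 0 (SU N)}
    (h₁ : ∀ U, start₁ p g U = h (Averaging.iter (avOfRecord F N p.K) k U) * b U) (h₀ : ∀ U, start₀ p g U = b U)
    (s : SeqOfRecord F ν τ.M g p.K k) :
    (fun V => texpAOfRecordFrom F N ν τ.M start₁ w (rstepSlotOfRecord F N ν τ ppSel) p g k s V)
      =ᵐ[fieldMeasure (F.P p.K) k (SU N)]
      fun V => h V * texpAOfRecordFrom F N ν τ.M start₀ w (rstepSlotOfRecord F N ν τ ppSel) p g k s V := by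
  have hiter := measurable_iter (avOfRecord F N p.K) (avOfRecord_measurable F N p.K) k
  have r₁ := texpAOfRecordFrom_eq_toReal_lintegral_slotMeasure hsel hw0 hwm hχm hbm hb0
    (gd := fun U => h (Averaging.iter (avOfRecord F N p.K) k U)) (hhm.comp hiter) hm hM0 (fun U => hlo _) (fun U => hhi _) h₁ k s
  have r₀ := texpAOfRecordFrom_eq_toReal_lintegral_slotMeasure hsel hw0 hwm hχm hbm hb0
    (gd := fun _ => (1 : ℝ)) measurable_const one_pos zero_le_one (fun _ => le_rfl) (fun _ => le_rfl)
    (start := start₀) (fun U => by rw [h₀, one_mul]) k s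
  filter_upwards [lintegral_comp_iter_slotMeasure_ae hwm hχm hbm k s fun V => ENNReal.ofReal (h V)] with V hV
  have hV' : ∫⁻ U, ENNReal.ofReal (h (Averaging.iter (avOfRecord F N p.K) k U)) ∂(slotMeasure F N ν τ w p g b k s V)
      = ENNReal.ofReal (h V) * slotMeasure F N ν τ w p g b k s V Set.univ := hV
  rw [r₁ V, r₀ V, hV']
  simp only [ENNReal.ofReal_one, lintegral_const, one_mul, ENNReal.toReal_mul, ENNReal.toReal_ofReal (hm.le.trans (hlo V))]

/-- ★ **(ρ4-c) THE CLASS WEIGHT OF A DRESSED SLOT IS THE DRESSED FORMAT OF THE VACUUM CLASS DENSITY**: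
`∫ χ_k(s)·dressedSlot_k(s) dHaar_k = ∫ (χ_k(s)·vacuumSlot_k(s)) · h dHaar_k` — at the record (`k = p.K`, `h = e^{t·φ}`) the left side is
`Node00.classWeightOfDatum₉ … t s` and the right side is LEDGER-DRESS's `hP` format (`N19LedgerDress.coreEdge_dress_of_vacuumLedgerAtSync`)
with `L.μ K t τ := fieldMeasure (F.P p.K) p.K (SU N)` (t-FREE, τ-free), integrand `χ·vacuumSlot`, `Wt := φ`; i.e. REP⁰ holds with
`ι :=` unit-lattice fields, `fld := id`.  [folklore ∕ bookkeeping] -/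
theorem integral_chi_mul_dressed_eq {ppSel : PpSelOfRecord F ν τ.M}
    (hsel : ∀ (k : ℕ) (s : SeqOfRecord F ν τ.M g p.K (k + 1)), ppSel p g (k + 1) s = s)
    (hw0 : ∀ k s' U V', 0 ≤ w p g k s' U V')
    (hwm : ∀ k s', Measurable fun z : GaugeField (F.P p.K) (k + 1) (SU N) × GaugeField (F.P p.K) k (SU N) => w p g k s' z.2 z.1)
    (hχm : ∀ k s, Measurable (chiSeqOfRecord F N ν τ.M g p.K k s))
    {b : GaugeField (F.P p.K) 0 (SU N) → ℝ} (hbm : Measurable b) (hb0 : ∀ U, 0 ≤ b U)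
    (k : ℕ) {h : GaugeField (F.P p.K) k (SU N) → ℝ} (hhm : Measurable h) {m M : ℝ} (hm : 0 < m) (hM0 : 0 ≤ M)
    (hlo : ∀ V, m ≤ h V) (hhi : ∀ V, h V ≤ M)
    {start₁ start₀ : (p : B12.RunParams) → (ℕ → ℝ) → Density (F.P p.K) 0 (SU N)}
    (h₁ : ∀ U, start₁ p g U = h (Averaging.iter (avOfRecord F N p.K) k U) * b U) (h₀ : ∀ U, start₀ p g U = b U)
    (s : SeqOfRecord F ν τ.M g p.K k) :
    ∫ V, chiSeqOfRecord F N ν τ.M g p.K k s V * texpAOfRecordFrom F N ν τ.M start₁ w (rstepSlotOfRecord F N ν τ ppSel) p g k s V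
        ∂fieldMeasure (F.P p.K) k (SU N)
      = ∫ V, (chiSeqOfRecord F N ν τ.M g p.K k s V * texpAOfRecordFrom F N ν τ.M start₀ w (rstepSlotOfRecord F N ν τ ppSel) p g k s V)
          * h V ∂fieldMeasure (F.P p.K) k (SU N) := by
  refine integral_congr_ae ?_
  filter_upwards [texpA_dressed_ae_eq_mul_vacuum hsel hw0 hwm hχm hbm hb0 k hhm hm hM0 hlo hhi h₁ h₀ s] with V hV
  rw [show texpAOfRecordFrom F N ν τ.M start₁ w (rstepSlotOfRecord F N ν τ ppSel) p g k s V
      = h V * texpAOfRecordFrom F N ν τ.M start₀ w (rstepSlotOfRecord F N ν τ ppSel) p g k s V from hV]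
  ring

/-- ★ **(ρ4-d) THE PUSH-FORWARD OF THE CLASS MEASURE UNDER THE ITERATED AVERAGING IS `Haar_k` WITH DENSITY `χ_k(s)·mass`** —
the literal discharge of the REP⁰ hypothesis at module A's objects: `(classMeasureOfSlots k s).map iter_k = Haar_k.withDensity (V ↦
ofReal (χ_k(s) V) · slotMeasure k s V univ)` (ρ3 + `lintegral_comp_eq_mul_of_ae_fibre` at `G := 𝟙_B`).  [folklore ∕ bookkeeping] -/
theorem map_iter_classMeasureOfSlots
    (hwm : ∀ k s', Measurable fun z : GaugeField (F.P p.K) (k + 1) (SU N) × GaugeField (F.P p.K) k (SU N) => w p g k s' z.2 z.1)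
    (hχm : ∀ k s, Measurable (chiSeqOfRecord F N ν τ.M g p.K k s)) {b : GaugeField (F.P p.K) 0 (SU N) → ℝ} (hbm : Measurable b)
    (k : ℕ) (s : SeqOfRecord F ν τ.M g p.K k) :
    (classMeasureOfSlots F N ν τ w p g b k s).map (Averaging.iter (avOfRecord F N p.K) k)
      = (fieldMeasure (F.P p.K) k (SU N)).withDensity
          fun V => ENNReal.ofReal (chiSeqOfRecord F N ν τ.M g p.K k s V) * slotMeasure F N ν τ w p g b k s V Set.univ := by
  have hiter := measurable_iter (avOfRecord F N p.K) (avOfRecord_measurable F N p.K) k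
  have hQm := measurable_slotMeasure hwm hχm hbm k s
  ext B hB
  have hm2 : Measurable fun V => slotMeasure F N ν τ w p g b k s V (Averaging.iter (avOfRecord F N p.K) k ⁻¹' B) :=
    (Measure.measurable_coe (hB.preimage hiter)).comp hQm
  rw [Measure.map_apply hiter hB, classMeasureOfSlots, Measure.bind_apply (hB.preimage hiter) hQm.aemeasurable,
    lintegral_withDensity_eq_lintegral_mul₀ (hχm k s).ennreal_ofReal.aemeasurable hm2.aemeasurable,
    withDensity_apply _ hB, ← lintegral_indicator hB]
  refine lintegral_congr_ae ?_
  filter_upwards [slotMeasure_fibre_ae hwm hχm hbm k s] with V hV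
  have e1 : slotMeasure F N ν τ w p g b k s V (Averaging.iter (avOfRecord F N p.K) k ⁻¹' B)
      = B.indicator 1 V * slotMeasure F N ν τ w p g b k s V Set.univ := by
    rw [← lintegral_indicator_one (hB.preimage hiter), ← lintegral_comp_eq_mul_of_ae_fibre hV (B.indicator 1)]
    refine lintegral_congr fun U => ?_
    by_cases hU : Averaging.iter (avOfRecord F N p.K) k U ∈ B
    · rw [Set.indicator_of_mem hU, Set.indicator_of_mem (show U ∈ _ ⁻¹' B from hU), Pi.one_apply, Pi.one_apply]
    · rw [Set.indicator_of_notMem hU, Set.indicator_of_notMem (show U ∉ _ ⁻¹' B from hU)]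
  show ENNReal.ofReal (chiSeqOfRecord F N ν τ.M g p.K k s V) * slotMeasure F N ν τ w p g b k s V (Averaging.iter (avOfRecord F N p.K) k ⁻¹' B)
    = B.indicator (fun V => ENNReal.ofReal (chiSeqOfRecord F N ν τ.M g p.K k s V) * slotMeasure F N ν τ w p g b k s V Set.univ) V
  rw [e1]
  by_cases hVB : V ∈ B
  · rw [Set.indicator_of_mem hVB, Set.indicator_of_mem hVB, Pi.one_apply, one_mul]
  · rw [Set.indicator_of_notMem hVB, Set.indicator_of_notMem hVB, zero_mul, mul_zero]

/-- ★ **(ρ4-e) REP⁰ IN THE SHAPE n19-d DISPLAYS IT** (INTENT-30 `…N19LedgerDressAtRecord`, `hrep : (classMeasureOfSlots … s).map (Nf.A p.K) =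
(μ.withDensity (ofReal ∘ f)).map fld`): whenever the unit reading factors through the iterated averaging of record, `Nf.A p.K = rd ∘ iter_k`
(`rd` measurable), REP⁰ HOLDS with `μ := fieldMeasure (F.P p.K) k (SU N)` (t-free), `fld := rd` and the REAL density
`f V := (ofReal (χ_k(s) V) · slotMeasure k s V univ).toReal` (finite mass pointwise, module A `slotMeasure_univ_lt_top`).  [folklore ∕ bookkeeping] -/
theorem map_comp_iter_classMeasureOfSlots {X : Type*} [MeasurableSpace X]
    (hwm : ∀ k s', Measurable fun z : GaugeField (F.P p.K) (k + 1) (SU N) × GaugeField (F.P p.K) k (SU N) => w p g k s' z.2 z.1)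
    (hχm : ∀ k s, Measurable (chiSeqOfRecord F N ν τ.M g p.K k s)) {b : GaugeField (F.P p.K) 0 (SU N) → ℝ} (hbm : Measurable b)
    (k : ℕ) (s : SeqOfRecord F ν τ.M g p.K k) {rd : GaugeField (F.P p.K) k (SU N) → X} (hrd : Measurable rd) :
    (classMeasureOfSlots F N ν τ w p g b k s).map (rd ∘ Averaging.iter (avOfRecord F N p.K) k)
      = ((fieldMeasure (F.P p.K) k (SU N)).withDensity fun V => ENNReal.ofReal
          ((ENNReal.ofReal (chiSeqOfRecord F N ν τ.M g p.K k s V) * slotMeasure F N ν τ w p g b k s V Set.univ).toReal)).map rd := by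
  have hiter := measurable_iter (avOfRecord F N p.K) (avOfRecord_measurable F N p.K) k
  have e : (fun V => ENNReal.ofReal
      ((ENNReal.ofReal (chiSeqOfRecord F N ν τ.M g p.K k s V) * slotMeasure F N ν τ w p g b k s V Set.univ).toReal))
      = fun V => ENNReal.ofReal (chiSeqOfRecord F N ν τ.M g p.K k s V) * slotMeasure F N ν τ w p g b k s V Set.univ :=
    funext fun V => ENNReal.ofReal_toReal (ENNReal.mul_ne_top ENNReal.ofReal_ne_top (slotMeasure_univ_lt_top b k s V).ne)
  rw [← Measure.map_map hrd hiter, map_iter_classMeasureOfSlots hwm hχm hbm k s, e]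

/-- ★★ **(ρ4-f) REP⁰ WITH THE HAAR REFERENCE ON ANY RELABELLED TORUS AND `fld := id`** (the shape NODE O's `LedgerDataSync` wants: ONE reading
space `ι := GaugeField P' j' (SU N)` — e.g. the unit-lattice fields — ONE reference measure, its product Haar measure, for ALL `K t τ` and BOTH runs):
for a bond relabelling `ε : PBond P' j' ≃ PBond (F.P p.K) k` (`T4AveragingDisintegration.relabel`, `map_relabel_fieldMeasure`),
`(classMeasureOfSlots k s).map (relabel ε ∘ iter_k) = Haar_{P',j'}.withDensity ((χ_k(s)·mass_k(s)) ∘ relabel ε.symm)`.  So INTENT-30's `hrepA`∕`hrepB`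
with `L.μ K t τ := fieldMeasure P' j' (SU N)`, `fld := id` REDUCE TO the a.e. IDENTIFICATION of the ledger's own integrand `(∏ e^{E(u(v))−E(1)})·o(v)` with
def-T's vacuum class density read through the relabelling — NODE O's (2.23) representation content proper ((B1)–(B3) of lens v8 F13), and nothing
measure-theoretic.  [folklore ∕ bookkeeping] -/
theorem map_relabel_iter_classMeasureOfSlots {P' : Params} {j' : ℕ}
    (hwm : ∀ k s', Measurable fun z : GaugeField (F.P p.K) (k + 1) (SU N) × GaugeField (F.P p.K) k (SU N) => w p g k s' z.2 z.1)
    (hχm : ∀ k s, Measurable (chiSeqOfRecord F N ν τ.M g p.K k s)) {b : GaugeField (F.P p.K) 0 (SU N) → ℝ} (hbm : Measurable b)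
    (k : ℕ) (s : SeqOfRecord F ν τ.M g p.K k) (ε : PBond P' j' ≃ PBond (F.P p.K) k) :
    (classMeasureOfSlots F N ν τ w p g b k s).map (relabel ε ∘ Averaging.iter (avOfRecord F N p.K) k)
      = (fieldMeasure P' j' (SU N)).withDensity fun V' =>
          ENNReal.ofReal (chiSeqOfRecord F N ν τ.M g p.K k s (relabel ε.symm V'))
            * slotMeasure F N ν τ w p g b k s (relabel ε.symm V') Set.univ := by
  have hiter := measurable_iter (avOfRecord F N p.K) (avOfRecord_measurable F N p.K) k
  have hF : Measurable fun V => ENNReal.ofReal (chiSeqOfRecord F N ν τ.M g p.K k s V) * slotMeasure F N ν τ w p g b k s V Set.univ :=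
    (hχm k s).ennreal_ofReal.mul ((Measure.measurable_coe MeasurableSet.univ).comp (measurable_slotMeasure hwm hχm hbm k s))
  have hinv : ∀ U : GaugeField (F.P p.K) k (SU N), relabel ε.symm (relabel ε U) = U := fun U => by
    funext b'
    simp only [relabel_apply, Equiv.apply_symm_apply]
  rw [← Measure.map_map (measurable_relabel ε) hiter, map_iter_classMeasureOfSlots hwm hχm hbm k s,
    map_withDensity_of_leftInverse _ hF (measurable_relabel ε) (measurable_relabel ε.symm) hinv, map_relabel_fieldMeasure]
  rfl

end Record

end Summit.QuantumFields.YangMills.BalabanUVNodes.N19ClassMeasurePushforward
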